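import Summits.ValiantsHypothesis.ValiantsHypothesis.Theorems.KPlusLogSqLawTropicalBSplit

/-!
# Route `KPlusLogSqLaw`, crux `TropicalB` — the split inequality, CHAIN-LEVEL form

HONEST FRAMING.  Helper file toward the registered stubs `stub_tropThin` / `stub_tropFat` of
`Cruxes/TropicalB/Lines/birth.lean` (crux `Summit.ValiantsHypothesis.ValiantsHypothesis.Theses.KPlusLogSqLaw.TropicalB`,
ledger item `stmt-ValiantsHypothesis-19771`, route `KPlusLogSqLaw`, DRAFT; cell `pub-symmetroid`, seat `val-sym-trop-p1`,
2026-08-26).  Nothing here proves any part of a stub; nothing asserts `TropicalB`, `KPlusLogSqLaw`, `MatrixDescartes`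
or anything about `VP ≠ VNP`.

The split inequality `designRowD_split` (companion file …TropicalBSplit) asks the state family `𝓡` to contain the
first-block row set of EVERY present term.  Its proof only uses the states of the chain's own terms, so the same bound
holds chain by chain:

* `chain_split` — if the first-block row sets of the terms of a dominant chain (distinct consecutive terms) all lie in `𝓡`,
  then `n + 1 ≤ #𝓡·(B₁ + B₂ + 1)`;
* `chain_le_card_states_mul` — with `TropRowD c K B₁`, `TropRowD e K B₂`: `n + 1 ≤ #{distinct first-block row sets
  ALONG THE CHAIN}·(B₁ + B₂ + 1)`.

Reading for general supports (where no a-priori state bound exists): the breakpoints of a dominant chain are controlled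
by the number of block states the chain itself visits, at every column cut, recursively.  [folklore]
-/

set_option linter.dupNamespace false
set_option autoImplicit false

namespace Summit.ValiantsHypothesis.ValiantsHypothesis.Theorems.KPlusLogSqLaw

open Summit.ValiantsHypothesis.ValiantsHypothesis.Theorems.MatrixDescartes.Negative
open Summit.ValiantsHypothesis.ValiantsHypothesis.Theorems.LacunarySymmetroidMatrixDescartes
open Summit.ValiantsHypothesis.ValiantsHypothesis.Theorems.LacunarySymmetroidMatrixDescartes.TropicalCensus
open scoped BigOperators
open Finset

/-! ## The chain-level split inequality -/

section ChainSplit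

variable {c e K : ℕ}

/-- **Chain-level split inequality.**  The same bound as `designRowD_split`, but the state family `𝓡` only needs to
contain the first-block row sets of the terms of the GIVEN chain (not of every present term): if the chain
`p₀, …, pₙ` is dominant at strictly increasing slopes with distinct consecutive terms and `st (p k) ∈ 𝓡` for all `k`,
then `n + 1 ≤ #𝓡·(B₁ + B₂ + 1)`.  Use: a design class with no a-priori state bound still obeys the recursion along
any chain whose block states are few. [folklore] -/
theorem chain_split (d : Fin K → ℕ) (v ε : Fin (c + e) → Fin (c + e) → Fin K → ℤ)
    (𝓡 : Finset (Finset (Fin (c + e)))) (h𝓡 : ∀ R ∈ 𝓡, R.card = c) {B₁ B₂ : ℕ}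
    (h₁ : ∀ R ∈ 𝓡, ∀ r : Fin c ↪o Fin (c + e), (∀ i, r i ∈ R) →
      DesignRowD d (fun i j l => v (r i) (Fin.castAdd e j) l) (fun i j l => ε (r i) (Fin.castAdd e j) l) B₁)
    (h₂ : ∀ R ∈ 𝓡, ∀ r : Fin e ↪o Fin (c + e), (∀ i, r i ∉ R) →
      DesignRowD d (fun i j l => v (r i) (Fin.natAdd c j) l) (fun i j l => ε (r i) (Fin.natAdd c j) l) B₂)
    {n : ℕ} (θ : Fin (n + 1) → ℤ) (p : Fin (n + 1) → Equiv.Perm (Fin (c + e)) × (Fin (c + e) → Fin K))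
    (hθ : StrictMono θ) (hdom : ∀ k, IsDominant d v ε (θ k) (p k)) (hne : ∀ k : Fin n, p k.castSucc ≠ p k.succ)
    (hst : ∀ k, ((univ : Finset (Fin c)).image fun j => (p k).1 (Fin.castAdd e j)) ∈ 𝓡) :
    n + 1 ≤ 𝓡.card * (B₁ + B₂ + 1) := by
  classical
  set st : Fin (n + 1) → Finset (Fin (c + e)) := fun k => univ.image fun j : Fin c => (p k).1 (Fin.castAdd e j)
    with hst_def
  have hfib : ∀ R ∈ 𝓡, (univ.filter fun k => st k = R).card ≤ B₁ + B₂ + 1 := by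
    intro R hR
    have hRc : R.card = c := h𝓡 R hR
    have hRcc : Rᶜ.card = e := by rw [card_compl, Fintype.card_fin, hRc]; omega
    set r₁ : Fin c ↪o Fin (c + e) := R.orderEmbOfFin hRc with hr₁def
    set r₂ : Fin e ↪o Fin (c + e) := Rᶜ.orderEmbOfFin hRcc with hr₂def
    have hr₁mem : ∀ i, r₁ i ∈ R := fun i => orderEmbOfFin_mem R hRc i
    have hr₂mem : ∀ i, r₂ i ∉ R := fun i => mem_compl.mp (orderEmbOfFin_mem Rᶜ hRcc i)
    have hdisj : ∀ i j, r₁ i ≠ r₂ j := fun i j h => hr₂mem j (h ▸ hr₁mem i)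
    have hran₁ : ∀ x ∈ R, ∃ i, r₁ i = x := by
      intro x hx
      have : x ∈ Set.range (R.orderEmbOfFin hRc) := by rw [range_orderEmbOfFin]; exact mem_coe.mpr hx
      exact this
    have hran₂ : ∀ x ∈ Rᶜ, ∃ i, r₂ i = x := by
      intro x hx
      have : x ∈ Set.range (Rᶜ.orderEmbOfFin hRcc) := by rw [range_orderEmbOfFin]; exact mem_coe.mpr hx
      exact this
    refine card_fiber_le d v ε r₁ r₂ _ _ _ _ r₁.injective r₂.injective hdisj
      (fun _ _ _ => rfl) (fun _ _ _ => rfl) (fun _ _ _ => rfl) (fun _ _ _ => rfl)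
      (h₁ R hR r₁ hr₁mem) (h₂ R hR r₂ hr₂mem) θ p hθ hdom hne _ ?_
    intro k hk
    have hk' : st k = R := (mem_filter.mp hk).2
    refine ⟨fun j => hran₁ _ ?_, fun j => hran₂ _ ?_⟩
    · rw [← hk']
      exact mem_image_of_mem _ (mem_univ j)
    · rw [mem_compl, ← hk']
      intro hmem
      obtain ⟨j', _, hj'⟩ := mem_image.mp hmem
      exact castAdd_ne_natAdd j' j ((p k).1.injective hj')
  calc n + 1 = (univ : Finset (Fin (n + 1))).card := by simp
    _ = ∑ R ∈ 𝓡, ((univ : Finset (Fin (n + 1))).filter fun k => st k = R).card :=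
        card_eq_sum_card_fiberwise fun k _ => hst k
    _ ≤ ∑ _R ∈ 𝓡, (B₁ + B₂ + 1) := sum_le_sum hfib
    _ = 𝓡.card * (B₁ + B₂ + 1) := by rw [sum_const, smul_eq_mul]

/-- **States along a chain.**  The number of breakpoints of an unsigned dominant chain is controlled by the number of
DISTINCT first-block row sets its own terms use: `n + 1 ≤ #{st (p k)}·(B₁ + B₂ + 1)`, with `B₁`, `B₂` unsigned row
bounds valid for all restricted designs of the two column blocks (e.g. `TropRowD c K B₁`, `TropRowD e K B₂`). [folklore] -/
theorem chain_le_card_states_mul (d : Fin K → ℕ) (v ε : Fin (c + e) → Fin (c + e) → Fin K → ℤ) {B₁ B₂ : ℕ}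
    (h₁ : TropRowD c K B₁) (h₂ : TropRowD e K B₂)
    {n : ℕ} (θ : Fin (n + 1) → ℤ) (p : Fin (n + 1) → Equiv.Perm (Fin (c + e)) × (Fin (c + e) → Fin K))
    (hθ : StrictMono θ) (hdom : ∀ k, IsDominant d v ε (θ k) (p k)) (hne : ∀ k : Fin n, p k.castSucc ≠ p k.succ) :
    n + 1 ≤ ((univ : Finset (Fin (n + 1))).image fun k =>
        (univ : Finset (Fin c)).image fun j => (p k).1 (Fin.castAdd e j)).card * (B₁ + B₂ + 1) := by
  classical
  refine chain_split d v ε _ (fun R hR => ?_) (fun R _ r _ => h₁ _ _ _) (fun R _ r _ => h₂ _ _ _) θ p hθ hdom hne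
    (fun k => mem_image_of_mem _ (mem_univ k))
  obtain ⟨k, _, rfl⟩ := mem_image.mp hR
  have hinj : Function.Injective fun j : Fin c => (p k).1 (Fin.castAdd e j) :=
    (p k).1.injective.comp (Fin.castAdd_injective _ _)
  rw [card_image_of_injective _ hinj, card_univ, Fintype.card_fin]

end ChainSplit

end Summit.ValiantsHypothesis.ValiantsHypothesis.Theorems.KPlusLogSqLaw
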